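import Literature.Computability.QuantumComplexity.SignedCubicForrelation
import Literature.Computability.QuantumComplexity.ForrelationMSubspaceDuality
import Literature.Computability.QuantumComplexity.QuadraticPolarForm

/-!
# Crux `CubicForrelation.SignedExactCubicForrelationNotPrBPP` (stmt-QuantumAdvantage-13932) — stub `stub_polarGeometry`

Stub `stub_polarGeometry` of line `dual-pingpong-frame`: the POLAR GEOMETRY of a Maiorana–McFarland-shaped
`g(y', y'') = y'·π(y'') ⊕ h(y'')` on `𝔽₂^{m+m}` with coordinatewise-quadratic `π` (`IsDegLeFun 2`); no hypothesis
on `h`, `π` not assumed bijective; inner products spelled `(univ.filter fun i => uᵢ ∧ zᵢ).card.bodd`; no definitions.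
* `xor_frame_eq`: `g(y) ⊕ g(y ⊕ (u',0)) = u'·π(y'')` for every `h` (bilinearity `bdot_bxor_left`, via `BLR.toZ`).
* `xor8_of_isDegLeFun_two`: third differences of a quadratic function vanish (tree calculus
  `QuadPolar.toZFun_mem_lowDeg_of_poly` + `der_der_der_eq_zero`); hence the bracket
  `π(x) ⊕ π(x⊕v) ⊕ π(x⊕w) ⊕ π(x⊕w⊕v)` is the constant `B_π(v,w) = π(v⊕w) ⊕ π(v) ⊕ π(w) ⊕ π(0)` (`quad_bracket`,
  `bdot_bracket`), and `B_π(a,·)` is additive with `B_π(a,a) = B_π(a,0) = 0` (`bv_bxor`, `bv_self`, `bv_zero_right`).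
* (A) `d3_frame_eq`: `D_{(u',0)} D_{(v',v'')} D_{(w',w'')} g (x) = u'·B_π(v'', w'')`, independent of `x, v', w'`.
* (B) `d3_seed_eq`, `seed_leak`: `D_w D_{(u',0)} D_v g (x) = u'·B_π(w'', v'')`; if `w'' = 0` any `u' ≠ 0` works
  (`0 < m`), else `B_π(w'',·)` is additive, kills `w''`, so is not injective hence not onto; its image `S ∋ 0` is
  `⊕`-closed with `|S| < 2^m` and `|S|·|S^⊥| = 2^m` (`DerivativeWalsh.card_mul_card_perp`) gives a non-zero
  `u' ∈ S^⊥` (`exists_perp_of_additive`, bridge `twist_eq_one_iff_bdot`).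
References: C. Carlet, *Boolean Functions for Cryptography and Coding Theory*, CUP 2020, Prop. 54, §2.2.2, §5.2
[Carlet2020]; R. O'Donnell, *Analysis of Boolean Functions*, CUP 2014, §3.3 [ODonnell2014]. NOT here: bijective `π` /
duals (`stub_dualShape`), M-subspaces (`stub_frameLock`), signs (`stub_signReadout`), machines (`stub_plumbing`).
-/

noncomputable section

set_option linter.dupNamespace false -- D-0017: single-problem summit ⇒ `QuantumAdvantage.QuantumAdvantage` by design

namespace Summit.QuantumAdvantage.QuantumAdvantage.Theorems.SignedExactCubicForrelationNotPrBPP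

open Finset
open Literature.Computability.Complexity Literature.Computability.QuantumComplexity
open Literature.Computability.QuantumComplexity.BuzetChailloux (bxor zeroVec bxor_self bxor_comm
  bxor_zeroVec zeroVec_bxor)
open Literature.Computability.Complexity.BLR (toZ toZ_xor toZ_injective)

namespace PolarGeometry

variable {m : ℕ}

/-! ### Boolean and bit-vector bookkeeping -/

/-- Regrouping `(a⊕b⊕c⊕d) ⊕ (e⊕f⊕g⊕h)` into the pairs `(a⊕b)⊕(c⊕d)`, `(e⊕f)⊕(g⊕h)`. [folklore] -/
theorem xor_pairs12 (a b c d e f g h : Bool) :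
    ((a ^^ b ^^ c ^^ d) ^^ (e ^^ f ^^ g ^^ h)) =
      (((a ^^ b) ^^ (c ^^ d)) ^^ ((e ^^ f) ^^ (g ^^ h))) := by
  revert a b c d e f g h; decide

/-- Regrouping `(a⊕b⊕c⊕d) ⊕ (e⊕f⊕g⊕h)` into the pairs `(a⊕c)⊕(b⊕d)`, `(e⊕g)⊕(f⊕h)`. [folklore] -/
theorem xor_pairs13 (a b c d e f g h : Bool) :
    ((a ^^ b ^^ c ^^ d) ^^ (e ^^ f ^^ g ^^ h)) =
      (((a ^^ c) ^^ (b ^^ d)) ^^ ((e ^^ g) ^^ (f ^^ h))) := by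
  revert a b c d e f g h; decide

/-- From the vanishing of an `8`-fold xor to the bracket identity of `quad_bracket`. [folklore] -/
theorem xor_rearrange_bracket (A B C D E F G H : Bool)
    (h : (D ^^ C ^^ B ^^ A ^^ E ^^ G ^^ F ^^ H) = false) :
    ((A ^^ B) ^^ (C ^^ D)) = (E ^^ F ^^ G ^^ H) := by
  revert A B C D E F G H; decide

/-- From the vanishing of an `8`-fold xor to the additivity identity of `bv_bxor`. [folklore] -/
theorem xor_rearrange_bv (P Q R S T X Y Z : Bool)
    (h : (P ^^ Q ^^ R ^^ S ^^ T ^^ X ^^ Y ^^ Z) = false) :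
    (P ^^ S ^^ T ^^ Z) = ((Q ^^ S ^^ X ^^ Z) ^^ (R ^^ S ^^ Y ^^ Z)) := by
  revert P Q R S T X Y Z; decide

/-- `x ⊕ (u ⊕ v) = (x ⊕ v) ⊕ u`. [folklore] -/
theorem bxor_bxor_swap {n : ℕ} (x u v : Fin n → Bool) : bxor x (bxor u v) = bxor (bxor x v) u := by
  funext i
  show (x i ^^ (u i ^^ v i)) = ((x i ^^ v i) ^^ u i)
  cases x i <;> cases u i <;> cases v i <;> rfl

/-- `x ⊕ (w ⊕ u) = (x ⊕ w) ⊕ u`. [folklore] -/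
theorem bxor_bxor_assoc {n : ℕ} (x w u : Fin n → Bool) : bxor x (bxor w u) = bxor (bxor x w) u := by
  funext i
  show (x i ^^ (w i ^^ u i)) = ((x i ^^ w i) ^^ u i)
  cases x i <;> cases w i <;> cases u i <;> rfl

/-- Every `x ∈ 𝔽₂^{m+m}` is a pair `(x', x'')`. [folklore] -/
theorem exists_append (x : Fin (m + m) → Bool) : ∃ x' x'' : Fin m → Bool, Fin.append x' x'' = x :=
  ⟨fun i => x (Fin.castAdd m i), fun j => x (Fin.natAdd m j), Fin.append_castAdd_natAdd⟩

/-- `(a, b) ⊕ (c, d) = (a ⊕ c, b ⊕ d)`. [folklore] -/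
theorem bxor_append (a b c d : Fin m → Bool) :
    bxor (Fin.append a b) (Fin.append c d) = Fin.append (bxor a c) (bxor b d) := by
  funext i
  refine Fin.addCases (fun j => ?_) (fun j => ?_) i
  · simp only [bxor, Fin.append_left]
  · simp only [bxor, Fin.append_right]

/-! ### The inner product bit `u·z = (univ.filter fun i => uᵢ ∧ zᵢ).card.bodd` and its bilinearity -/

/-- `(n : 𝔽₂) = [n odd]`, the parity bit read in `𝔽₂`. [folklore] -/
theorem natCast_eq_toZ_bodd (n : ℕ) : (n : ZMod 2) = toZ n.bodd := by
  induction n with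
  | zero => simp [BLR.toZ]
  | succ n ih =>
    rw [Nat.cast_succ, ih, Nat.bodd_add, Nat.bodd_one]
    cases n.bodd <;> decide

/-- The inner product read in `𝔽₂` is the sum `∑ᵢ [uᵢ ∧ zᵢ]`. [folklore] -/
theorem toZ_bdot (u z : Fin m → Bool) :
    toZ (univ.filter fun i => u i && z i).card.bodd = ∑ i, toZ (u i && z i) := by
  rw [← natCast_eq_toZ_bodd, Finset.natCast_card_filter]
  rfl

/-- Bilinearity on the left: `(a ⊕ b)·z = a·z ⊕ b·z`. [folklore] -/
theorem bdot_bxor_left (a b z : Fin m → Bool) :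
    (univ.filter fun i => bxor a b i && z i).card.bodd =
      ((univ.filter fun i => a i && z i).card.bodd ^^ (univ.filter fun i => b i && z i).card.bodd) := by
  apply toZ_injective
  rw [toZ_xor, toZ_bdot, toZ_bdot, toZ_bdot, ← sum_add_distrib]
  refine sum_congr rfl fun i _ => ?_
  show toZ ((a i ^^ b i) && z i) = _
  cases a i <;> cases b i <;> cases z i <;> decide

/-- Bilinearity on the right: `u·(a ⊕ b) = u·a ⊕ u·b`. [folklore] -/
theorem bdot_bxor_right (u a b : Fin m → Bool) :
    (univ.filter fun i => u i && bxor a b i).card.bodd =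
      ((univ.filter fun i => u i && a i).card.bodd ^^ (univ.filter fun i => u i && b i).card.bodd) := by
  apply toZ_injective
  rw [toZ_xor, toZ_bdot, toZ_bdot, toZ_bdot, ← sum_add_distrib]
  refine sum_congr rfl fun i _ => ?_
  show toZ (u i && (a i ^^ b i)) = _
  cases u i <;> cases a i <;> cases b i <;> decide

/-- Symmetry: `u·z = z·u`. [folklore] -/
theorem bdot_comm (u z : Fin m → Bool) :
    (univ.filter fun i => u i && z i).card.bodd = (univ.filter fun i => z i && u i).card.bodd := by
  apply toZ_injective
  rw [toZ_bdot, toZ_bdot]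
  exact sum_congr rfl fun i _ => by rw [Bool.and_comm]

/-- `n.bodd = false ↔ n` even. [folklore] -/
theorem bodd_eq_false_iff_even (n : ℕ) : n.bodd = false ↔ Even n := by
  rw [Nat.even_iff, Nat.mod_two_of_bodd]
  cases n.bodd <;> simp

/-- Bridge to the characters of `ForrelationMSubspaceDuality`: `(-1)^{s·u} = 1 ↔ s·u = 0`. [folklore] -/
theorem twist_eq_one_iff_bdot (s u : Fin m → Bool) :
    twist s u = 1 ↔ (univ.filter fun i => s i && u i).card.bodd = false := by
  rw [Simon.twist_eq_one_iff]
  unfold Simon.EvenOverlap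
  exact (bodd_eq_false_iff_even _).symm

/-! ### Third differences of quadratic functions -/

/-- **Third differences of a quadratic Boolean function vanish**: for `f` of algebraic degree `≤ 2`,
`⊕_{y ∈ x ⊕ span{a,b,c}} f(y) = 0` (the `8` points counted with multiplicity). Read off the tree's
derivative calculus: `[f] ∈ lowDeg 2` and `D_a D_b D_c [f] = 0`. [cite: Carlet2020, §2.2.2] -/
theorem xor8_of_isDegLeFun_two {f : (Fin m → Bool) → Bool} (hf : IsDegLeFun 2 f)
    (x a b c : Fin m → Bool) :
    (f (bxor (bxor (bxor x a) b) c) ^^ f (bxor (bxor x a) b) ^^ f (bxor (bxor x a) c) ^^ f (bxor x a) ^^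
      f (bxor (bxor x b) c) ^^ f (bxor x b) ^^ f (bxor x c) ^^ f x) = false := by
  obtain ⟨p, hp, hfp⟩ := hf
  have hQ : QuadPolar.toZFun f ∈ CHHL2018.lowDeg m 2 := QuadPolar.toZFun_mem_lowDeg_of_poly p hp hfp
  have h0 : toZ (f (bxor (bxor (bxor x a) b) c)) + toZ (f (bxor (bxor x a) b)) +
      (toZ (f (bxor (bxor x a) c)) + toZ (f (bxor x a))) +
      (toZ (f (bxor (bxor x b) c)) + toZ (f (bxor x b)) + (toZ (f (bxor x c)) + toZ (f x))) = 0 :=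
    congrFun (QuadPolar.der_der_der_eq_zero hQ a b c) x
  apply toZ_injective
  rw [toZ_xor, toZ_xor, toZ_xor, toZ_xor, toZ_xor, toZ_xor, toZ_xor, show toZ false = 0 from rfl]
  linear_combination h0

/-- **The bracket of a quadratic function is its polar form**:
`f(x) ⊕ f(x⊕v) ⊕ f(x⊕w) ⊕ f(x⊕w⊕v) = f(v⊕w) ⊕ f(v) ⊕ f(w) ⊕ f(0)` for `f` of degree `≤ 2`
(the two sides differ by a third difference). [cite: Carlet2020, §5.2] -/
theorem quad_bracket {f : (Fin m → Bool) → Bool} (hf : IsDegLeFun 2 f) (x v w : Fin m → Bool) :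
    ((f x ^^ f (bxor x v)) ^^ (f (bxor x w) ^^ f (bxor (bxor x w) v))) =
      (f (bxor v w) ^^ f v ^^ f w ^^ f zeroVec) := by
  have h8 := xor8_of_isDegLeFun_two hf zeroVec x w v
  simp only [zeroVec_bxor] at h8
  rw [bxor_comm w v] at h8
  exact xor_rearrange_bracket _ _ _ _ _ _ _ _ h8

/-- `B_π(a, 0) = 0` for the bilinear differential `B_π(a, t) = π(a ⊕ t) ⊕ π(a) ⊕ π(t) ⊕ π(0)` of a map
`π : 𝔽₂^m → 𝔽₂^m` (no degree hypothesis). [folklore] -/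
theorem bv_zero_right (π : (Fin m → Bool) → Fin m → Bool) (a : Fin m → Bool) :
    (fun i => (π (bxor a zeroVec) i ^^ π a i ^^ π zeroVec i ^^ π zeroVec i)) = (zeroVec : Fin m → Bool) := by
  funext i
  show (π (bxor a zeroVec) i ^^ π a i ^^ π zeroVec i ^^ π zeroVec i) = false
  rw [bxor_zeroVec]
  cases π a i <;> cases π zeroVec i <;> rfl

/-- `B_π(a, a) = 0` (the polar form is alternating; no degree hypothesis). [folklore] -/
theorem bv_self (π : (Fin m → Bool) → Fin m → Bool) (a : Fin m → Bool) :
    (fun i => (π (bxor a a) i ^^ π a i ^^ π a i ^^ π zeroVec i)) = (zeroVec : Fin m → Bool) := by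
  funext i
  show (π (bxor a a) i ^^ π a i ^^ π a i ^^ π zeroVec i) = false
  rw [bxor_self]
  cases π a i <;> cases π zeroVec i <;> rfl

/-- **`B_π(a, ·)` is additive** for coordinatewise-quadratic `π` (bilinearity of the polar form).
[cite: Carlet2020, §5.2] -/
theorem bv_bxor {π : (Fin m → Bool) → Fin m → Bool} (hπ : ∀ i, IsDegLeFun 2 fun y => π y i)
    (a t t' : Fin m → Bool) :
    (fun i => (π (bxor a (bxor t t')) i ^^ π a i ^^ π (bxor t t') i ^^ π zeroVec i)) =
      bxor (fun i => (π (bxor a t) i ^^ π a i ^^ π t i ^^ π zeroVec i))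
        (fun i => (π (bxor a t') i ^^ π a i ^^ π t' i ^^ π zeroVec i)) := by
  funext i
  have h8 := xor8_of_isDegLeFun_two (hπ i) zeroVec a t t'
  simp only [zeroVec_bxor] at h8
  rw [← bxor_bxor_assoc a t t'] at h8
  show (π (bxor a (bxor t t')) i ^^ π a i ^^ π (bxor t t') i ^^ π zeroVec i) =
    ((π (bxor a t) i ^^ π a i ^^ π t i ^^ π zeroVec i) ^^ (π (bxor a t') i ^^ π a i ^^ π t' i ^^ π zeroVec i))
  exact xor_rearrange_bv _ _ _ _ _ _ _ _ h8

/-- The `u`-component of the bracket of `π` is `u·B_π(v, w)` (coordinatewise `quad_bracket`, then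
linearity of `u·(-)`). [cite: Carlet2020, §5.2] -/
theorem bdot_bracket {π : (Fin m → Bool) → Fin m → Bool} (hπ : ∀ i, IsDegLeFun 2 fun y => π y i)
    (u x v w : Fin m → Bool) :
    (((univ.filter fun i => u i && π x i).card.bodd ^^ (univ.filter fun i => u i && π (bxor x v) i).card.bodd) ^^
      ((univ.filter fun i => u i && π (bxor x w) i).card.bodd ^^
        (univ.filter fun i => u i && π (bxor (bxor x w) v) i).card.bodd)) =
      (univ.filter fun i => u i && (π (bxor v w) i ^^ π v i ^^ π w i ^^ π zeroVec i)).card.bodd := by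
  rw [← bdot_bxor_right, ← bdot_bxor_right, ← bdot_bxor_right]
  refine congrArg (fun z : Fin m → Bool => (univ.filter fun i => u i && z i).card.bodd) ?_
  funext i
  exact quad_bracket (hπ i) x v w

/-! ### Derivatives of an MM-shaped function along frame vectors -/

/-- **Frame derivative**: if `g(y', y'') = y'·π(y'') ⊕ h(y'')` then
`g(y', y'') ⊕ g(y' ⊕ u', y'') = u'·π(y'')` for every `h`. [cite: Carlet2020, Prop. 54] -/
theorem xor_frame_eq {g : (Fin (m + m) → Bool) → Bool} {π : (Fin m → Bool) → Fin m → Bool}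
    {h : (Fin m → Bool) → Bool}
    (hg : ∀ y' y'' : Fin m → Bool,
      g (Fin.append y' y'') = ((Finset.univ.filter fun i => y' i && (π y'') i).card.bodd ^^ h y''))
    (u' y' y'' : Fin m → Bool) :
    (g (Fin.append y' y'') ^^ g (Fin.append (bxor y' u') y'')) =
      (univ.filter fun i => u' i && π y'' i).card.bodd := by
  rw [hg, hg, bdot_bxor_left]
  generalize (univ.filter fun i => y' i && π y'' i).card.bodd = A
  generalize (univ.filter fun i => u' i && π y'' i).card.bodd = B
  generalize h y'' = C
  cases A <;> cases B <;> cases C <;> rfl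

/-- **(A) as an identity**: the third derivative `D_{(u',0)} D_{(v',v'')} D_{(w',w'')} g (x', x'')` of an
MM-shaped `g` with coordinatewise-quadratic `π` is the constant `u'·B_π(v'', w'')`.
[cite: Carlet2020, Prop. 54] -/
theorem d3_frame_eq {g : (Fin (m + m) → Bool) → Bool} {π : (Fin m → Bool) → Fin m → Bool}
    {h : (Fin m → Bool) → Bool}
    (hg : ∀ y' y'' : Fin m → Bool,
      g (Fin.append y' y'') = ((Finset.univ.filter fun i => y' i && (π y'') i).card.bodd ^^ h y''))
    (hπ : ∀ i, IsDegLeFun 2 fun y => π y i) (u' v' v'' w' w'' x' x'' : Fin m → Bool) :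
    ((g (Fin.append x' x'') ^^ g (bxor (Fin.append x' x'') (Fin.append u' zeroVec)) ^^
          g (bxor (Fin.append x' x'') (Fin.append v' v'')) ^^
          g (bxor (Fin.append x' x'') (bxor (Fin.append u' zeroVec) (Fin.append v' v'')))) ^^
        (g (bxor (Fin.append x' x'') (Fin.append w' w'')) ^^
          g (bxor (bxor (Fin.append x' x'') (Fin.append w' w'')) (Fin.append u' zeroVec)) ^^
          g (bxor (bxor (Fin.append x' x'') (Fin.append w' w'')) (Fin.append v' v'')) ^^
          g (bxor (bxor (Fin.append x' x'') (Fin.append w' w''))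
            (bxor (Fin.append u' zeroVec) (Fin.append v' v''))))) =
      (univ.filter fun i => u' i && (π (bxor v'' w'') i ^^ π v'' i ^^ π w'' i ^^ π zeroVec i)).card.bodd := by
  rw [bxor_bxor_swap (Fin.append x' x'') (Fin.append u' zeroVec) (Fin.append v' v''),
    bxor_bxor_swap (bxor (Fin.append x' x'') (Fin.append w' w'')) (Fin.append u' zeroVec) (Fin.append v' v''),
    xor_pairs12]
  simp only [bxor_append, bxor_zeroVec]
  rw [xor_frame_eq hg u' x' x'', xor_frame_eq hg u' (bxor x' v') (bxor x'' v''),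
    xor_frame_eq hg u' (bxor x' w') (bxor x'' w''),
    xor_frame_eq hg u' (bxor (bxor x' w') v') (bxor (bxor x'' w'') v'')]
  exact bdot_bracket hπ u' x'' v'' w''

/-- **(B) as an identity**: `D_{(w',w'')} D_{(u',0)} D_{(v',v'')} g (x', x'') = u'·B_π(w'', v'')`.
[cite: Carlet2020, Prop. 54] -/
theorem d3_seed_eq {g : (Fin (m + m) → Bool) → Bool} {π : (Fin m → Bool) → Fin m → Bool}
    {h : (Fin m → Bool) → Bool}
    (hg : ∀ y' y'' : Fin m → Bool,
      g (Fin.append y' y'') = ((Finset.univ.filter fun i => y' i && (π y'') i).card.bodd ^^ h y''))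
    (hπ : ∀ i, IsDegLeFun 2 fun y => π y i) (u' w' w'' v' v'' x' x'' : Fin m → Bool) :
    ((g (Fin.append x' x'') ^^ g (bxor (Fin.append x' x'') (Fin.append w' w'')) ^^
          g (bxor (Fin.append x' x'') (Fin.append u' zeroVec)) ^^
          g (bxor (Fin.append x' x'') (bxor (Fin.append w' w'') (Fin.append u' zeroVec)))) ^^
        (g (bxor (Fin.append x' x'') (Fin.append v' v'')) ^^
          g (bxor (bxor (Fin.append x' x'') (Fin.append v' v'')) (Fin.append w' w'')) ^^
          g (bxor (bxor (Fin.append x' x'') (Fin.append v' v'')) (Fin.append u' zeroVec)) ^^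
          g (bxor (bxor (Fin.append x' x'') (Fin.append v' v''))
            (bxor (Fin.append w' w'') (Fin.append u' zeroVec))))) =
      (univ.filter fun i => u' i && (π (bxor w'' v'') i ^^ π w'' i ^^ π v'' i ^^ π zeroVec i)).card.bodd := by
  rw [bxor_bxor_assoc (Fin.append x' x'') (Fin.append w' w'') (Fin.append u' zeroVec),
    bxor_bxor_assoc (bxor (Fin.append x' x'') (Fin.append v' v'')) (Fin.append w' w'') (Fin.append u' zeroVec),
    xor_pairs13]
  simp only [bxor_append, bxor_zeroVec]
  rw [xor_frame_eq hg u' x' x'', xor_frame_eq hg u' (bxor x' w') (bxor x'' w''),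
    xor_frame_eq hg u' (bxor x' v') (bxor x'' v''),
    xor_frame_eq hg u' (bxor (bxor x' v') w') (bxor (bxor x'' v'') w'')]
  exact bdot_bracket hπ u' x'' w'' v''

/-- **Orthogonal of a proper additive image**: if `φ : 𝔽₂^m → 𝔽₂^m` is additive, `φ(0) = 0` and
`φ(a) = 0` for some `a ≠ 0`, then some `u' ≠ 0` is orthogonal to the whole image of `φ`
(`φ` is not injective, hence not onto; its image `S` is `⊕`-closed with `|S| < 2^m`, and
`|S|·|S^⊥| = 2^m` forces `|S^⊥| ≥ 2`). [cite: ODonnell2014, §3.3] -/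
theorem exists_perp_of_additive {φ : (Fin m → Bool) → (Fin m → Bool)} {a : Fin m → Bool}
    (ha : a ≠ zeroVec) (hzero : φ zeroVec = zeroVec) (hself : φ a = zeroVec)
    (hadd : ∀ t t', φ (bxor t t') = bxor (φ t) (φ t')) :
    ∃ u' : Fin m → Bool, u' ≠ zeroVec ∧ ∀ t, (univ.filter fun i => u' i && φ t i).card.bodd = false := by
  have hnot_inj : ¬ Function.Injective φ := fun hinj => ha (hinj (hself.trans hzero.symm))
  have hnot_surj : ¬ Function.Surjective φ := fun hs =>
    hnot_inj (Finite.injective_iff_surjective.2 hs)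
  unfold Function.Surjective at hnot_surj
  push Not at hnot_surj
  obtain ⟨t₀, ht₀⟩ := hnot_surj
  set S : Finset (Fin m → Bool) := univ.image φ with hS
  have h0 : zeroVec ∈ S := mem_image.2 ⟨zeroVec, mem_univ _, hzero⟩
  have haddS : ∀ x ∈ S, ∀ y ∈ S, bxor x y ∈ S := by
    intro x hx y hy
    obtain ⟨t, -, rfl⟩ := mem_image.1 hx
    obtain ⟨t', -, rfl⟩ := mem_image.1 hy
    exact mem_image.2 ⟨bxor t t', mem_univ _, hadd t t'⟩
  have hSlt : S.card < 2 ^ m := by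
    have hss : S ⊂ univ := by
      refine ssubset_univ_iff.2 fun hSu => ?_
      have ht : t₀ ∈ S := hSu ▸ mem_univ t₀
      obtain ⟨t, -, ht⟩ := mem_image.1 ht
      exact ht₀ t ht
    have := card_lt_card hss
    rwa [card_univ, Fintype.card_fun, Fintype.card_bool, Fintype.card_fin] at this
  have key : ∀ P : Finset (Fin m → Bool), (S.card : ℝ) * P.card = (2 : ℝ) ^ m → 1 < P.card := by
    intro P hP
    have hPN : S.card * P.card = 2 ^ m := by exact_mod_cast hP
    by_contra hle
    push Not at hle
    have h1 := Nat.mul_le_mul_left S.card hle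
    rw [hPN, mul_one] at h1
    exact absurd hSlt (not_lt.2 h1)
  obtain ⟨u', hu'P, hu'ne⟩ :=
    exists_mem_ne (key _ (DerivativeWalsh.card_mul_card_perp h0 haddS)) zeroVec
  refine ⟨u', hu'ne, fun t => ?_⟩
  rw [bdot_comm]
  exact (twist_eq_one_iff_bdot _ _).1 ((mem_filter.1 hu'P).2 _ (mem_image.2 ⟨t, mem_univ _, rfl⟩))

/-- **Seed leak**: for coordinatewise-quadratic `π` on `𝔽₂^m`, `0 < m`, and any `a`, some `u' ≠ 0`
satisfies `u'·B_π(a, t) = 0` for all `t` (`a = 0`: `B_π(0, ·) = 0` and `u' = 1^m ≠ 0`; `a ≠ 0`: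
`exists_perp_of_additive` for the additive map `B_π(a, ·)`, which kills `a`). [cite: Carlet2020, §5.2] -/
theorem seed_leak (hm : 0 < m) {π : (Fin m → Bool) → Fin m → Bool}
    (hπ : ∀ i, IsDegLeFun 2 fun y => π y i) (a : Fin m → Bool) :
    ∃ u' : Fin m → Bool, u' ≠ zeroVec ∧
      ∀ t, (univ.filter fun i => u' i && (π (bxor a t) i ^^ π a i ^^ π t i ^^ π zeroVec i)).card.bodd = false := by
  by_cases ha : a = zeroVec
  · subst ha
    refine ⟨fun _ => true, fun h0 => ?_, fun t => ?_⟩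
    · have := congrFun h0 ⟨0, hm⟩
      simp [zeroVec] at this
    · have hempty : (univ.filter fun i => true && (π t i ^^ π zeroVec i ^^ π t i ^^ π zeroVec i)) = ∅ :=
        filter_eq_empty_iff.2 fun i _ => by cases π t i <;> cases π zeroVec i <;> decide
      show (univ.filter fun i =>
        true && (π (bxor zeroVec t) i ^^ π zeroVec i ^^ π t i ^^ π zeroVec i)).card.bodd = false
      rw [zeroVec_bxor, hempty, card_empty, Nat.bodd_zero]
  · exact exists_perp_of_additive (φ := fun t i => (π (bxor a t) i ^^ π a i ^^ π t i ^^ π zeroVec i)) ha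
      (bv_zero_right π a) (bv_self π a) (bv_bxor hπ a)

end PolarGeometry

open PolarGeometry in
/-- **Polar geometry of a Maiorana–McFarland-shaped cubic** (stub `stub_polarGeometry` of line
`dual-pingpong-frame`, crux stmt-QuantumAdvantage-13932). For `g(y', y'') = y'·π(y'') ⊕ h(y'')` on
`𝔽₂^{m+m}` (`0 < m`, `π` coordinatewise of degree `≤ 2`, `h` arbitrary):
(A) for frame vectors `u = (u', 0)` and any `v = (v', v'')`, the third derivatives
`D_u D_v D_w g (x)` vanish for all `w, x` iff `u'·B_π(v'', w'') = 0` for all `w''`, where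
`B_π(v, w) = π(v⊕w) ⊕ π(v) ⊕ π(w) ⊕ π(0)`; (B) for every `w` some `u' ≠ 0` has
`D_w D_{(u',0)} D_v g ≡ 0` for all `v`. Proof: `g(x) ⊕ g(x ⊕ (u',0)) = u'·π(x'')` for every `h`, so both
third derivatives equal `u'·(π(x'') ⊕ π(x''⊕v'') ⊕ π(x''⊕w'') ⊕ π(x''⊕v''⊕w'')) = u'·B_π(v'', w'')`
(third differences of the quadratic coordinates of `π` vanish); for (B), `B_π(w'', ·)` is additive and
kills `w''`, so for `w'' ≠ 0` its image `S` is a proper `⊕`-closed subset and `|S|·|S^⊥| = 2^m` yields a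
non-zero `u' ∈ S^⊥`, while for `w'' = 0` any `u' ≠ 0` works. [cite: Carlet2020, Prop. 54] -/
theorem stub_polarGeometry :
    ∀ (m : ℕ), 0 < m → ∀ (g : (Fin (m + m) → Bool) → Bool) (π : (Fin m → Bool) → (Fin m → Bool))
    (h : (Fin m → Bool) → Bool),
    (∀ y' y'' : Fin m → Bool, g (Fin.append y' y'') = ((Finset.univ.filter fun i => y' i && (π y'') i).card.bodd ^^ h y'')) →
    (∀ i, IsDegLeFun 2 fun y => π y i) →
    (∀ u' v' v'' : Fin m → Bool,
      (∀ w x : Fin (m + m) → Bool,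
        ((g x ^^ g (bxor x (Fin.append u' zeroVec)) ^^ g (bxor x (Fin.append v' v'')) ^^ g (bxor x (bxor (Fin.append u' zeroVec) (Fin.append v' v'')))) ^^ (g (bxor x w) ^^ g (bxor (bxor x w) (Fin.append u' zeroVec)) ^^ g (bxor (bxor x w) (Fin.append v' v'')) ^^ g (bxor (bxor x w) (bxor (Fin.append u' zeroVec) (Fin.append v' v''))))) = false) ↔
      ∀ w'' : Fin m → Bool,
        (Finset.univ.filter fun i => u' i && (π (bxor v'' w'') i ^^ π v'' i ^^ π w'' i ^^ π zeroVec i)).card.bodd = false) ∧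
    (∀ w : Fin (m + m) → Bool, ∃ u' : Fin m → Bool, u' ≠ zeroVec ∧ ∀ v x : Fin (m + m) → Bool,
        ((g x ^^ g (bxor x w) ^^ g (bxor x (Fin.append u' zeroVec)) ^^ g (bxor x (bxor w (Fin.append u' zeroVec)))) ^^ (g (bxor x v) ^^ g (bxor (bxor x v) w) ^^ g (bxor (bxor x v) (Fin.append u' zeroVec)) ^^ g (bxor (bxor x v) (bxor w (Fin.append u' zeroVec))))) = false) := by
  intro m hm g π h hg hπ
  refine ⟨fun u' v' v'' => ⟨fun H w'' => ?_, fun H w x => ?_⟩, fun w => ?_⟩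
  · have key := d3_frame_eq hg hπ u' v' v'' zeroVec w'' zeroVec zeroVec
    rw [H] at key
    exact key.symm
  · obtain ⟨w', w'', rfl⟩ := exists_append w
    obtain ⟨x', x'', rfl⟩ := exists_append x
    rw [d3_frame_eq hg hπ u' v' v'' w' w'' x' x'']
    exact H w''
  · obtain ⟨w', w'', rfl⟩ := exists_append w
    obtain ⟨u', hne, hu'⟩ := seed_leak hm hπ w''
    refine ⟨u', hne, fun v x => ?_⟩
    obtain ⟨v', v'', rfl⟩ := exists_append v
    obtain ⟨x', x'', rfl⟩ := exists_append x
    rw [d3_seed_eq hg hπ u' w' w'' v' v'' x' x'']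
    exact hu' v''

end Summit.QuantumAdvantage.QuantumAdvantage.Theorems.SignedExactCubicForrelationNotPrBPP

end
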